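import Mathlib
import HarnessLib
import Summits.Ventures.LatticeQCDFlow.Scoring.EmpiricalProcessIncrement
import Summits.Ventures.LatticeQCDFlow.Scoring.QuantileBand
import Summits.Ventures.LatticeQCDFlow.Scoring.AsymptoticCoverage

/-!
# The SAMPLE-QUANTILE central limit theorem: for iid draws with distribution function `F`,
# `F(q) = u ∈ (0,1)`, `F′(q) = f`, the empirical `u`-quantile satisfies
# `P(√n(q̂ₙ − q) ≤ x) → P(−x·f ≤ W)`, `W ∼ N(0, u(1 − u))` — i.e. `√n(q̂ₙ − q)` is
# asymptotically `N(0, u(1 − u)/f²)` when `f > 0`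

HONEST FRAMING: exact (Metropolis-corrected) sampling algorithms for lattice gauge theory;
figures of merit are autocorrelation/cost numbers at stated couplings and volumes; no
continuum-physics claim.

Venture `LatticeQCDFlow` (cell pub-lqcd), topic `Scoring`; FANOUT row 4 (`s0-u1-b`, rung S0-B).
The printed card reports medians and percentiles of a statistic;
`Scoring/SampleQuantileConsistency` proved them consistent and `Scoring/QuantileBand` gave a
finite-sample bracket; this file gives their ERROR BAR: the classical asymptotic normality of a
sample quantile.  Proof by inversion, without the Bahadur representation and without a
triangular-array CLT: for fixed `x` and `tₙ = q + x/√n`, the Galois connection of lower quantiles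
(`Scoring/GlivenkoCantelliSandwich.cdf_quantile_spec`, applied to the empirical measure whose
distribution function is the empirical one, `Scoring/QuantileBand.cdf_empiricalMeasure`) gives
`{√n(q̂ₙ − q) ≤ x} = {u ≤ F̂ₙ(tₙ)} = {0 ≤ Yₙ − cₙ}` with
`Yₙ = (√n)⁻¹(Σ 1{Xᵢ ≤ tₙ} − nF(tₙ)) ⇒ W` (`Scoring/EmpiricalProcessIncrement.edf_clt_moving`)
and the deterministic `cₙ = √n(u − F(tₙ)) → −x·f` (the derivative); Slutsky gives
`Yₙ − cₙ ⇒ W + x·f`, whose law `N(x·f, u(1 − u))` has no atom at `0`, so the portmanteau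
theorem for the continuity set `[0, ∞)` (`Scoring/AsymptoticCoverage`) concludes:
**`sampleQuantile_clt_cdf`**.  NEW WORK of the cell (classical; our formalisation, not in
Mathlib); no definition; nothing cited as a fact.

## Content

* `tendsto_sqrt_mul_cdf_sub` — `√n(F(q + x/√n) − F(q)) → x·f`;
* **`sampleQuantile_clt_cdf`** — THE THEOREM, in distribution-function form.

NOT CLAIMED: the `TendstoInDistribution` packaging (convergence of distribution functions at
every point is equivalent on `ℝ`, not re-derived here); a studentised version with an estimated
density `f`; the reweighted card's quantiles.
-/

noncomputable section

namespace Summit.Ventures.LatticeQCDFlow.Scoring.GlivenkoCantelli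

open MeasureTheory ProbabilityTheory Finset Filter Function
open scoped Topology ENNReal

/-! ## §1 The deterministic centring -/

section Centring

/-- **`√n(F(q + x/√n) − F(q)) → x·f`** when `F` has derivative `f` at `q`. [ours] -/
theorem tendsto_sqrt_mul_cdf_sub {F : ℝ → ℝ} {q f : ℝ} (hF : HasDerivAt F f q) (x : ℝ) :
    Tendsto (fun n : ℕ => Real.sqrt n * (F (q + x / Real.sqrt n) - F q)) atTop (𝓝 (x * f)) := by
  rcases eq_or_ne x 0 with hx | hx
  · subst hx
    simp
  -- `hₙ = x/√n → 0`, `hₙ ≠ 0` eventually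
  have hsqrt : Tendsto (fun n : ℕ => Real.sqrt n) atTop atTop :=
    Real.tendsto_sqrt_atTop.comp tendsto_natCast_atTop_atTop
  have hh : Tendsto (fun n : ℕ => x / Real.sqrt n) atTop (𝓝 0) := by
    have h := (tendsto_inv_atTop_zero.comp hsqrt).const_mul x
    simpa [div_eq_mul_inv] using h
  have hh0 : ∀ᶠ n : ℕ in atTop, x / Real.sqrt n ∈ ({0}ᶜ : Set ℝ) := by
    filter_upwards [eventually_ge_atTop 1] with n hn
    have : (0 : ℝ) < Real.sqrt n := Real.sqrt_pos.2 (by exact_mod_cast hn)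
    exact div_ne_zero hx this.ne'
  have hwithin := tendsto_nhdsWithin_of_tendsto_nhds_of_eventually_within _ hh hh0
  have hslope := (hasDerivAt_iff_tendsto_slope_zero.1 hF).comp hwithin
  -- `√n (F(q + hₙ) − F q) = x · hₙ⁻¹ (F(q + hₙ) − F q)` for `n ≥ 1`
  have hmul := hslope.const_mul x
  refine hmul.congr' ?_
  filter_upwards [eventually_ge_atTop 1] with n hn
  have hs : (0 : ℝ) < Real.sqrt n := Real.sqrt_pos.2 (by exact_mod_cast hn)
  simp only [Function.comp_apply, smul_eq_mul]
  field_simp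

end Centring

/-! ## §2 The theorem -/

section Quantile

variable {Ω : Type*} [MeasurableSpace Ω] {P : Measure Ω} [IsProbabilityMeasure P]
variable {Ω' : Type*} [MeasurableSpace Ω'] {P' : Measure Ω'} [IsProbabilityMeasure P']
variable {X : ℕ → Ω → ℝ}

/-- **THE SAMPLE-QUANTILE CENTRAL LIMIT THEOREM (distribution-function form).**  iid real
`Xᵢ` with law `ρ = P ∘ X₀⁻¹` and `F = cdf ρ`; a level `u ∈ (0, 1)` and a point `q` with
`F(q) = u` at which `F` has derivative `f`; the empirical lower `u`-quantile
`q̂ₙ = inf{x : u ≤ cdf(n⁻¹Σ_{i<n} δ_{Xᵢ}) x}`; `W ∼ N(0, u(1 − u))`.  Then for every real `x`,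
`P(√n(q̂ₙ − q) ≤ x) → P(−x·f ≤ W)` (`= Φ(x·f/√(u(1 − u)))`): for `f > 0`, `√n(q̂ₙ − q)` is
asymptotically centred normal with variance `u(1 − u)/f²` (for `f = 0` the limit is the
constant `1/2`: no `√n`-rate). [ours] -/
theorem sampleQuantile_clt_cdf (hXm : ∀ i, Measurable (X i)) (hind : iIndepFun X P)
    (hid : ∀ i, IdentDistrib (X i) (X 0) P P) {u q f : ℝ} (hu0 : 0 < u) (hu1 : u < 1)
    (hFq : cdf (P.map (X 0)) q = u) (hderiv : HasDerivAt (fun s => cdf (P.map (X 0)) s) f q)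
    {W : Ω' → ℝ} (hW : HasLaw W (gaussianReal 0 (u * (1 - u)).toNNReal) P') (x : ℝ) :
    Tendsto (fun n : ℕ => P.real {ω | Real.sqrt n
        * (sInf {s | u ≤ cdf (((n : ℝ≥0∞)⁻¹) • ∑ i ∈ range n, Measure.dirac (X i ω)) s} - q) ≤ x})
      atTop (𝓝 (P'.real {ω' | -(x * f) ≤ W ω'})) := by
  haveI : IsProbabilityMeasure (P.map (X 0)) :=
    Measure.isProbabilityMeasure_map (hXm 0).aemeasurable
  set F : ℝ → ℝ := fun s => cdf (P.map (X 0)) s with hFdef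
  set t : ℕ → ℝ := fun n => q + x / Real.sqrt n with ht
  -- `F(tₙ) → F(q)`
  have hsqrt : Tendsto (fun n : ℕ => Real.sqrt n) atTop atTop :=
    Real.tendsto_sqrt_atTop.comp tendsto_natCast_atTop_atTop
  have htq : Tendsto t atTop (𝓝 q) := by
    have h := (tendsto_inv_atTop_zero.comp hsqrt).const_mul x
    have h' : Tendsto (fun n : ℕ => q + x * (Real.sqrt n)⁻¹) atTop (𝓝 (q + x * 0)) :=
      tendsto_const_nhds.add h
    rw [mul_zero, add_zero] at h'
    refine h'.congr fun n => ?_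
    simp [ht, div_eq_mul_inv]
  have hFt : Tendsto (fun n => cdf (P.map (X 0)) (t n)) atTop (𝓝 (cdf (P.map (X 0)) q)) :=
    (hderiv.continuousAt.tendsto).comp htq
  -- the empirical process at the moving point, limit `W ∼ N(0, u(1 − u))`
  have hW' : HasLaw W (gaussianReal 0
      (cdf (P.map (X 0)) q * (1 - cdf (P.map (X 0)) q)).toNNReal) P' := by
    rw [hFq]
    exact hW
  have hY := edf_clt_moving hXm hind hid hFt hW'
  -- the deterministic centring `cₙ = √n(u − F tₙ) → −x·f`, as a constant-in-ω sequence
  have hc : Tendsto (fun n : ℕ => -(Real.sqrt n * (u - cdf (P.map (X 0)) (t n)))) atTop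
      (𝓝 (x * f)) := by
    have h := tendsto_sqrt_mul_cdf_sub hderiv x
    refine h.congr fun n => ?_
    simp only [ht, ← hFq]
    ring
  have hcM : TendstoInMeasure P (fun (n : ℕ) (_ : Ω) =>
      -(Real.sqrt n * (u - cdf (P.map (X 0)) (t n)))) atTop fun _ => x * f :=
    tendstoInMeasure_of_tendsto_ae (fun n => aestronglyMeasurable_const)
      (Eventually.of_forall fun _ => hc)
  have hZ := hY.add_of_tendstoInMeasure_const hcM (fun n => aemeasurable_const)
  -- portmanteau on the continuity set `[0, ∞)` of the atomless law of `W + x·f`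
  have hWxf : HasLaw (fun ω' => W ω' + x * f) (gaussianReal (0 + x * f) (u * (1 - u)).toNNReal) P' :=
    gaussianReal_add_const hW (x * f)
  have hfr : (P'.map fun ω' => W ω' + x * f) (frontier (Set.Ici (0 : ℝ))) = 0 := by
    rw [hWxf.map_eq, frontier_Ici]
    have hv : (u * (1 - u)).toNNReal ≠ 0 := by
      rw [ne_eq, Real.toNNReal_eq_zero, not_le]
      exact mul_pos hu0 (by linarith)
    haveI := nullSingletonClass_gaussianReal (μ := 0 + x * f) hv
    exact measure_singleton 0
  have hlim := CardConsistency.tendsto_measureReal_preimage_of_tendstoInDistribution hZ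
    measurableSet_Ici hfr
  -- identify the limit set
  have elim : (fun ω' => W ω' + x * f) ⁻¹' Set.Ici 0 = {ω' | -(x * f) ≤ W ω'} := by
    ext ω'
    simp only [Set.mem_preimage, Set.mem_Ici, Set.mem_setOf_eq]
    constructor <;> intro h <;> linarith
  rw [elim] at hlim
  -- identify the events for `n ≥ 1`
  refine hlim.congr' ?_
  filter_upwards [eventually_ge_atTop 1] with n hn
  have hn0 : (0 : ℝ) < n := by exact_mod_cast hn
  have hs : 0 < Real.sqrt n := Real.sqrt_pos.2 hn0
  congr 1
  ext ω
  haveI := isProbabilityMeasure_empiricalMeasure (fun i => X i ω) hn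
  obtain ⟨-, -, hgal⟩ := cdf_quantile_spec
    (((n : ℝ≥0∞)⁻¹) • ∑ i ∈ range n, Measure.dirac (X i ω)) hu0 hu1
  simp only [Set.mem_preimage, Set.mem_Ici, Set.mem_setOf_eq, Pi.add_apply]
  rw [show Real.sqrt n * (sInf {s | u ≤ cdf (((n : ℝ≥0∞)⁻¹) • ∑ i ∈ range n,
      Measure.dirac (X i ω)) s} - q) ≤ x ↔ sInf {s | u ≤ cdf (((n : ℝ≥0∞)⁻¹)
        • ∑ i ∈ range n, Measure.dirac (X i ω)) s} ≤ t n by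
    rw [ht]
    simp only []
    rw [← le_div_iff₀' hs, sub_le_iff_le_add']]
  rw [hgal (t n), cdf_empiricalMeasure (fun i => X i ω) hn (t n)]
  -- `0 ≤ Yₙ + (−cₙ) ↔ u ≤ F̂ₙ(tₙ)`
  have e : (Real.sqrt n)⁻¹ * (∑ k ∈ range n, (Set.Iic (t n)).indicator (1 : ℝ → ℝ) (X k ω)
      - n * cdf (P.map (X 0)) (t n)) + -(Real.sqrt n * (u - cdf (P.map (X 0)) (t n)))
      = Real.sqrt n * ((∑ k ∈ range n, (Set.Iic (t n)).indicator (1 : ℝ → ℝ) (X k ω)) / n - u) := by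
    have hs0 : Real.sqrt n ≠ 0 := hs.ne'
    have hsn : (n : ℝ) = Real.sqrt n * Real.sqrt n := (Real.mul_self_sqrt hn0.le).symm
    generalize Real.sqrt (n : ℝ) = S at hs0 hsn ⊢
    rw [hsn]
    field_simp
    ring
  rw [e]
  constructor
  · intro h
    have := (mul_nonneg_iff_of_pos_left hs).1 h
    linarith
  · intro h
    exact mul_nonneg hs.le (by linarith)

end Quantile

end Summit.Ventures.LatticeQCDFlow.Scoring.GlivenkoCantelli

end
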